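import Literature.Probability.LatticeModels.PlaneRotatorComplexRotationBound
import Literature.MathematicalPhysics.QuantumLattice.HubbardBondPairDecaySharp
import HarnessLib

/-!
# McBryan–Spencer power-law decay of the two-point function of the two-dimensional classical XY
# model (plane rotator) on the torus `(ℤ/Lℤ)²`, uniformly in `L`, with the spin-wave exponent `1/(2πβJ)`

Topic `Literature/Probability/LatticeModels`. O. A. McBryan, T. Spencer, *On the decay of correlations in
SO(n)-symmetric ferromagnets*, Comm. Math. Phys. **53** (1977) 299–302 [McBryanSpencer1977], main
theorem (as transcribed in Fröhlich–Spencer, CMP 81 (1981) 527, eq. (1.31), and in S. Friedli,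
Y. Velenik, *Statistical Mechanics of Lattice Systems* (CUP 2017), Thm. 9.12 [FriedliVelenik2017]):
for the plane rotator on `ℤ²` at inverse temperature `β`, for every `ε > 0` there is `K(ε, β) < ∞` with
`0 ≤ ⟨S_0 · S_x⟩_β ≤ K (1 + |x|)^{−1/((2π+ε)β)}`; Friedli–Velenik: `|⟨S_i · S_j⟩_μ| ≤ ‖j−i‖₂^{−(1−ε)/(2πβ)}`
for `β ≥ β₀(ε)`. The exponent `1/(2πβ)` is the spin-wave (Gaussian) prediction (Friedli–Velenik (9.21)).

This file PROVES the bound in finite volume, uniformly in the volume, WITHOUT the `ε`: for the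
nearest-neighbour plane rotator on the discrete torus `(ℤ/Lℤ)²` (`L ≥ 3`; bond system `torusXY 2 L`,
one directed bond `(z,i) : z → z + eᵢ` per site and direction, Gibbs weight
`exp(J ∑_{(z,i)} cos(θ_{z+eᵢ} − θ_z)) ∏ dθ_z`, inverse temperature absorbed into `J = βJ_phys ≥ 0`),

* `torusXY_abs_expect_cosDiff_le_rpow` — for every `q ≥ 0` with `f = 2q − 2πJq² ≥ 0` and all `x, y`:
  `|⟨cos(θ_x − θ_y)⟩_{J,L}| ≤ exp(J(2πq² + 76q² + 544q⁴e^{2q²})) · 5^f · (dist(x,y) + 1)^{−f}`;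
* `torusXY_abs_expect_cosDiff_le_rpow_spinWave` — at the optimal charge `q = 1/(2πJ)` (`J > 0`):
  **`|⟨cos(θ_x − θ_y)⟩_{J,L}| ≤ K(J) · (dist(x,y) + 1)^{−1/(2πJ)}`**, `K(J) = mcBryanSpencerConst J`
  explicit, `dist` the periodic `ℓ^∞` distance — McBryan–Spencer's theorem with `ε = 0`.

The two ingredients are both in the tree: (i) the complex-rotation a-priori bound
`|⟨cos(θ_x − θ_y)⟩| ≤ e^{−(φ_x−φ_y)} exp(J ∑_a (cosh(∇φ)_a − 1))` for every real `φ`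
(`BondSystem.abs_expect_cosDiff_le_exp_cosh`, `PlaneRotatorComplexRotationBound.lean`; here rewritten
over ordered adjacent pairs of `torusGraph 2 L`, `torusXY_abs_expect_cosDiff_le_exp_cosh_adj`); (ii) the
Euclidean truncated logarithmic dipole on the torus with the McBryan–Spencer constant `2π` (gain
`2q log ρ`, energy `≤ 2(2πq²H(ρ) + 76q² + 544q⁴e^{2q²})`, `H` the harmonic number) and the generic step
"a-priori bound with gauge charge `c` and cost `b` for all flat potentials ⇒ `g ≤ K 5^f (dist+1)^{−f}`,
`f = 2cq − 4πbq²`" (`le_rpow_euclid_of_apriori_flat`, `TorusEuclidLogDipole` /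
`HubbardBondPairDecaySharp.lean`, written for the Koma–Tasaki bound of the Hubbard model and reused
verbatim with `c = 1`, `b = J/2`). Because the harmonic number carries the sharp coefficient of
`log ρ`, no `ε` is lost.

Use (cell `pub/hubbard-tc`, crux №2 "sharp Koma–Tasaki"): this is the CLASSICAL half — the rigorous
content of the key-K2 folklore `η(T) ≥ T/(2πJ)` for the XY layer; with the universal-jump reading
`η(T_BKT⁻) = 1/4` it gives `k_B T_BKT ≤ (π/2) J` (Nelson–Kosterlitz). The Hubbard (quantum) analogue
with the hopping NORM in place of `J`, `|⟨P_x† P_y⟩| ≲ |x−y|^{−1/(πβ|t|)}`, is the tree's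
`norm_thermalCorr_localPair_le_sharp`; the version with the STIFFNESS `D̃(T)` in place of `|t|` is the
open crux.

Not here: the lower bound `0 ≤ ⟨cos⟩` (Griffiths–Ginibre, tree `BondSystem.expect_one_cosDiff_nonneg`),
infinite volume / boundary conditions, `d ≠ 2`, `O(N)` with `N ≥ 3`, the angle-cube form (transport by
`integral_torusHaar_eq_smul_setIntegral_Icc` if needed).

## References

* O. A. McBryan, T. Spencer, Comm. Math. Phys. 53 (1977) 299–302. [McBryanSpencer1977]
* S. Friedli, Y. Velenik, *Statistical Mechanics of Lattice Systems*, CUP 2017, §9.4, Thm. 9.12,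
  (9.21)–(9.29), pp. 463–466. [FriedliVelenik2017]
* J. Fröhlich, T. Spencer, Comm. Math. Phys. 81 (1981) 527–602, eq. (1.31). [FrohlichSpencerKT1981]

Tree: `BondSystem.abs_expect_cosDiff_le_exp_cosh`, `le_rpow_euclid_of_apriori_flat`, `torusGraph_adj_iff`,
`torusDist`; two torus-sum lemmas are re-proved privately (adapted from `sum_ite_torusGraph_adj'`,
`sum_sum_ite_torusGraph_adj` of `XYZGroundStateOrderProofs.lean`) to avoid importing the quantum
spin-system files.
-/

noncomputable section

open MeasureTheory Finset
open scoped BigOperators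

namespace Literature.Probability.LatticeModels

open Literature.MathematicalPhysics.QuantumLattice (torusNormSq le_rpow_euclid_of_apriori_flat)

/-! ### The plane rotator on the discrete torus `(ℤ/Lℤ)^d` -/

/-- The nearest-neighbour plane rotator (classical XY model) on the discrete torus `(ℤ/Lℤ)^d` as a
bond system: one directed bond `(z, i) : z → z + eᵢ` per site and direction, i.e. the Gibbs weight
`exp(J ∑_{(z,i)} cos(θ_{z+eᵢ} − θ_z)) ∏ dθ_z` (the vocabulary of `setIntegral_torus_cos_mul_exp_nonneg`
and `FriedliVelenik2017_thm1025_planeRotator3`; for `L ≥ 3` every undirected nearest-neighbour bond of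
the torus graph appears exactly once). [folklore] -/
def torusXY (d L : ℕ) : BondSystem (TorusSite d L) (TorusSite d L × Fin d) :=
  ⟨Prod.fst, fun b => b.1 + Pi.single b.2 1⟩

/-- The source of the bond `(z, i)` is `z`. [folklore] -/
@[simp] private theorem torusXY_src (d L : ℕ) (b : TorusSite d L × Fin d) : (torusXY d L).src b = b.1 := rfl

/-- The target of the bond `(z, i)` is `z + eᵢ`. [folklore] -/
@[simp] private theorem torusXY_tgt (d L : ℕ) (b : TorusSite d L × Fin d) :
    (torusXY d L).tgt b = b.1 + Pi.single b.2 1 := rfl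

section TorusSums

variable {d L : ℕ} [NeZero L]

/-- For `L ≥ 3`, the neighbours of `x` in the torus graph are the `2d` distinct points `x ± eᵢ`:
`Σ_{y ∼ x} g(y) = Σᵢ (g(x + eᵢ) + g(x − eᵢ))` (adapted from the tree's
`sum_ite_torusGraph_adj'`, `XYZGroundStateOrderProofs.lean`, to avoid a heavy import). [folklore] -/
private theorem sum_ite_torusGraph_adj_real (hL : 3 ≤ L) (x : TorusSite d L) (g : TorusSite d L → ℝ) :
    (∑ y, if (torusGraph d L).Adj x y then g y else 0) =
      ∑ i, (g (x + Pi.single i 1) + g (x - Pi.single i 1)) := by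
  classical
  haveI : Fact (1 < L) := ⟨by omega⟩
  have h1 : (1 : ZMod L) ≠ 0 := one_ne_zero
  have h2 : (1 : ZMod L) + 1 ≠ 0 := by
    intro h
    have : ((2 : ℕ) : ZMod L) = 0 := by exact_mod_cast (by simpa [one_add_one_eq_two] using h)
    rw [ZMod.natCast_eq_zero_iff] at this
    exact absurd (Nat.le_of_dvd two_pos this) (by omega)
  have hsingle_ne : ∀ i : Fin d, (Pi.single i 1 : TorusSite d L) ≠ 0 := fun i h => by
    have := congrFun h i; simp [h1] at this
  have hsingle_inj : ∀ i j : Fin d, (Pi.single i 1 : TorusSite d L) = Pi.single j 1 → i = j := by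
    intro i j h
    by_contra hij
    have := congrFun h i
    simp [hij, h1] at this
  have hsum_ne : ∀ i j : Fin d, (Pi.single i 1 : TorusSite d L) + Pi.single j 1 ≠ 0 := by
    intro i j h
    have := congrFun h i
    by_cases hij : i = j
    · subst hij; simp [h2] at this
    · simp [Ne.symm hij, h1] at this
  set Np : Finset (TorusSite d L) := univ.image fun i => x + Pi.single i 1 with hNp
  set Nm : Finset (TorusSite d L) := univ.image fun i => x - Pi.single i 1 with hNm
  have hadj : ∀ y, (torusGraph d L).Adj x y ↔ y ∈ Np ∪ Nm := by
    intro y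
    rw [torusGraph_adj_iff, Finset.mem_union, Finset.mem_image, Finset.mem_image]
    constructor
    · rintro ⟨-, ⟨i, hi⟩ | ⟨i, hi⟩⟩
      · exact Or.inl ⟨i, mem_univ _, hi.symm⟩
      · exact Or.inr ⟨i, mem_univ _, by rw [hi, add_sub_cancel_right]⟩
    · rintro (⟨i, -, hi⟩ | ⟨i, -, hi⟩)
      · refine ⟨fun hxy => hsingle_ne i ?_, Or.inl ⟨i, hi.symm⟩⟩
        have := hi; rw [← hxy] at this; simpa using this.symm
      · refine ⟨fun hxy => hsingle_ne i ?_, Or.inr ⟨i, by rw [← hi, sub_add_cancel]⟩⟩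
        have := hi; rw [← hxy, sub_eq_self] at this; exact this
  have hdisj : Disjoint Np Nm := by
    rw [Finset.disjoint_left]
    intro y hp hm
    rw [hNp, Finset.mem_image] at hp
    rw [hNm, Finset.mem_image] at hm
    obtain ⟨i, -, rfl⟩ := hp
    obtain ⟨j, -, hj⟩ := hm
    apply hsum_ne i j
    have := hj
    rw [sub_eq_iff_eq_add, add_assoc, left_eq_add] at this
    exact this
  have hinjp : Set.InjOn (fun i : Fin d => x + Pi.single i 1) (univ : Finset (Fin d)) :=
    fun i _ j _ h => hsingle_inj i j (add_left_cancel h)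
  have hinjm : Set.InjOn (fun i : Fin d => x - Pi.single i 1) (univ : Finset (Fin d)) :=
    fun i _ j _ h => hsingle_inj i j (sub_right_injective h)
  calc (∑ y, if (torusGraph d L).Adj x y then g y else 0)
      = ∑ y, if y ∈ Np ∪ Nm then g y else 0 := by
        refine Finset.sum_congr rfl fun y _ => ?_
        simp only [hadj]
    _ = ∑ y ∈ Np ∪ Nm, g y := by rw [Finset.sum_ite_mem, Finset.univ_inter]
    _ = ∑ y ∈ Np, g y + ∑ y ∈ Nm, g y := Finset.sum_union hdisj
    _ = ∑ i, g (x + Pi.single i 1) + ∑ i, g (x - Pi.single i 1) := by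
        rw [hNp, hNm, Finset.sum_image hinjp, Finset.sum_image hinjm]
    _ = ∑ i, (g (x + Pi.single i 1) + g (x - Pi.single i 1)) := (Finset.sum_add_distrib).symm

/-- **Ordered adjacent pairs are twice the directed bonds `(x, x + eᵢ)`** (`L ≥ 3`, symmetric kernel):
`Σ_x Σ_{y ∼ x} F(x,y) = 2 Σ_x Σᵢ F(x, x + eᵢ)` (adapted from the tree's `sum_sum_ite_torusGraph_adj`,
`XYZGroundStateOrderProofs.lean`). [folklore] -/
private theorem sum_sum_ite_torusGraph_adj_real (hL : 3 ≤ L) (F : TorusSite d L → TorusSite d L → ℝ)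
    (hF : ∀ x y, F x y = F y x) :
    (∑ x, ∑ y, if (torusGraph d L).Adj x y then F x y else 0) =
      2 * ∑ x : TorusSite d L, ∑ i : Fin d, F x (x + Pi.single i 1) := by
  have hkey : ∀ x : TorusSite d L, (∑ y, if (torusGraph d L).Adj x y then F x y else 0) =
      ∑ i, (F x (x + Pi.single i 1) + F x (x - Pi.single i 1)) := fun x =>
    sum_ite_torusGraph_adj_real hL x (F x)
  simp_rw [hkey, sum_add_distrib]
  rw [two_mul]
  congr 1
  rw [sum_comm]
  conv_rhs => rw [sum_comm]
  refine sum_congr rfl fun i _ => ?_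
  refine (Fintype.sum_equiv (Equiv.addRight (Pi.single i (1 : ZMod L)))
    (fun x => F x (x + Pi.single i 1)) (fun x => F x (x - Pi.single i 1)) fun x => ?_).symm
  simp only [Equiv.coe_addRight, add_sub_cancel_right]
  exact hF _ _

end TorusSums

/-! ### The power-law bound on `(ℤ/Lℤ)²` -/

section PowerLaw

variable {L : ℕ} [NeZero L] [MeasurableSpace Circle] [BorelSpace Circle]

/-- The McBryan–Spencer a-priori bound on the torus in GRAPH form: for `L ≥ 3`, `J ≥ 0`, every
`φ : (ℤ/Lℤ)² → ℝ` and all `x, y`,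
`|⟨cos(θ_x − θ_y)⟩_{J,L}| ≤ e^{−(φ_x − φ_y)} · exp((J/2) Σ_u Σ_{v ∼ u} (cosh(φ_u − φ_v) − 1))`
(each undirected bond is one directed bond `(z,i)` and two ordered adjacent pairs).
[cite: FriedliVelenik2017, Thm 9.12, display (9.23)] -/
theorem torusXY_abs_expect_cosDiff_le_exp_cosh_adj (hL : 3 ≤ L) {J : ℝ} (hJ : 0 ≤ J)
    (φ : TorusSite 2 L → ℝ) (x y : TorusSite 2 L) :
    |(torusXY 2 L).expect J 1 (cosDiff x y)| ≤
      Real.exp (-(1 * (φ x - φ y))) * Real.exp (J / 2 * ∑ u : TorusSite 2 L, ∑ v : TorusSite 2 L,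
        (if (torusGraph 2 L).Adj u v then (Real.cosh (φ u - φ v) - 1) else 0)) := by
  have h := (torusXY 2 L).abs_expect_cosDiff_le_exp_cosh J φ x y hJ
  rw [one_mul]
  refine h.trans_eq ?_
  congr 2
  rw [sum_sum_ite_torusGraph_adj_real hL (fun u v => Real.cosh (φ u - φ v) - 1)
    (fun u v => by rw [← Real.cosh_neg, neg_sub]), Fintype.sum_prod_type]
  simp only [torusXY_tgt, torusXY_src]
  rw [← mul_assoc, div_mul_cancel₀ J two_ne_zero]
  congr 1
  refine Finset.sum_congr rfl fun z _ => Finset.sum_congr rfl fun i _ => ?_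
  rw [← Real.cosh_neg, neg_sub]

/-- **McBryan–Spencer power-law decay for the two-dimensional XY model, uniformly in the volume**
(McBryan–Spencer 1977, main theorem; Friedli–Velenik 2017, Thm 9.12), explicit finite-volume form on
the discrete torus `(ℤ/Lℤ)²`, `L ≥ 3`, free of `ε`: for the plane rotator with nearest-neighbour
coupling `J ≥ 0` (inverse temperature absorbed, `J = βJ_phys`), every `q ≥ 0` with
`f = 2q − 2πJq² ≥ 0`, and all sites `x, y`,

  `|⟨cos(θ_x − θ_y)⟩_{J,L}| ≤ exp(J(2πq² + 76q² + 544q⁴e^{2q²})) · 5^f · (dist(x,y) + 1)^{−f}`,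

`dist` the periodic `ℓ^∞` distance. The rotation field is the tree's Euclidean truncated logarithmic
dipole with the McBryan–Spencer constant `2π` (`TorusEuclidLogDipole`, assembled in
`le_rpow_euclid_of_apriori_flat`). [cite: McBryanSpencer1977, main theorem] -/
theorem torusXY_abs_expect_cosDiff_le_rpow (hL : 3 ≤ L) {J q f : ℝ} (hJ : 0 ≤ J) (hq : 0 ≤ q)
    (hfq : f = 2 * q - 2 * Real.pi * J * q ^ 2) (hf : 0 ≤ f) (x y : TorusSite 2 L) :
    |(torusXY 2 L).expect J 1 (cosDiff x y)| ≤
      Real.exp (J * (2 * Real.pi * q ^ 2 + 76 * q ^ 2 + 544 * q ^ 4 * Real.exp (2 * q ^ 2))) *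
        ((5 : ℝ) ^ f * ((Literature.MathematicalPhysics.QuantumLattice.torusDist x y : ℝ) + 1) ^ (-f)) := by
  have h := le_rpow_euclid_of_apriori_flat L (J / 2) 1 q (|(torusXY 2 L).expect J 1 (cosDiff x y)|) f
    (by positivity) hq x y
    (fun φ _ _ => torusXY_abs_expect_cosDiff_le_exp_cosh_adj hL hJ φ x y)
    (by rw [hfq]; ring) hf
  rwa [show 2 * (J / 2) = J by ring] at h

/-- The constant of the sharp bound: `K(J) = exp(J(2πq² + 76q² + 544q⁴e^{2q²})) · 5^{1/(2πJ)}` at the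
optimal charge `q = 1/(2πJ)`. [cite: McBryanSpencer1977, main theorem] -/
def mcBryanSpencerConst (J : ℝ) : ℝ :=
  Real.exp (J * (2 * Real.pi * (1 / (2 * Real.pi * J)) ^ 2 + 76 * (1 / (2 * Real.pi * J)) ^ 2 +
      544 * (1 / (2 * Real.pi * J)) ^ 4 * Real.exp (2 * (1 / (2 * Real.pi * J)) ^ 2))) *
    (5 : ℝ) ^ (1 / (2 * Real.pi * J))

/-- **McBryan–Spencer with the spin-wave exponent `1/(2πJ)`** (the optimal charge `q = 1/(2πJ)` in
`torusXY_abs_expect_cosDiff_le_rpow`): for `J > 0`, `L ≥ 3` and all `x, y ∈ (ℤ/Lℤ)²`,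

  `|⟨cos(θ_x − θ_y)⟩_{J,L}| ≤ K(J) · (dist(x,y) + 1)^{−1/(2πJ)}`,

uniformly in `L` — McBryan–Spencer's `|x|^{−1/((2π+ε)βJ)}` (for every `ε > 0`) and
Friedli–Velenik's `‖j−i‖^{−(1−ε)/(2πβ)}` (Thm 9.12, `β` large) with `ε = 0` and an explicit constant;
`1/(2πβJ)` is the spin-wave value (Friedli–Velenik (9.21)). [cite: McBryanSpencer1977, main theorem] -/
theorem torusXY_abs_expect_cosDiff_le_rpow_spinWave (hL : 3 ≤ L) {J : ℝ} (hJ : 0 < J)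
    (x y : TorusSite 2 L) :
    |(torusXY 2 L).expect J 1 (cosDiff x y)| ≤
      mcBryanSpencerConst J *
        ((Literature.MathematicalPhysics.QuantumLattice.torusDist x y : ℝ) + 1) ^ (-(1 / (2 * Real.pi * J))) := by
  have hq : 0 ≤ 1 / (2 * Real.pi * J) := by positivity
  have hf : (1 / (2 * Real.pi * J) : ℝ) = 2 * (1 / (2 * Real.pi * J)) - 2 * Real.pi * J * (1 / (2 * Real.pi * J)) ^ 2 := by
    field_simp
    ring
  have h := torusXY_abs_expect_cosDiff_le_rpow hL hJ.le hq hf hq x y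
  rwa [← mul_assoc] at h

end PowerLaw

end Literature.Probability.LatticeModels
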